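import Summits.QuantumFields.BalabanUV.Beta.GAN24.DirichletExhaustionCovariancePad
import Summits.QuantumFields.BalabanUV.Beta.GAN24.DirichletExhaustionDecays

/-!
# `BalabanUV.Beta.GAN24.DirichletExhaustionLimit` — binder row G-an2-4 ∕ (CONV-C), part P2, PART 23: THE `k = ∞` OBJECT OF ROAD P2's T
# NAMED — the padded END socket with a NAMED middle limit `Δ_∞`: the PERFECT covariance `C·(pad(CᵀΔ_∞C))_Λ⁻¹·Cᵀ` and the explicit rate
# `C^{(k)}_Λ → C^{(∞)}_Λ` (unit b2b-balaban-gan24-p2, gen 16, v1)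

NOT IN PRINT; OUR CONSTRUCTION (elementary composition of road P2's PARTS 1∕2∕3∕4∕10 BY NAME).  HONEST FRAMING (cell contract, verbatim):
«discharging `BetaPertH` makes Bałaban's UV stability UNCONDITIONAL — a real constructive-QFT result; it is NOT the continuum limit and NOT the
Clay problem.»  HONEST DEPENDENCY (verbatim): «continuum YM on T⁴ ⇐ BetaPertH ∧ nine spine estimates (0/9 proved); BetaPertH ⇐ (D1) ∧ (D4) ∧
CAP+tail; G-an2-4 gates asym, D1 and NE2/3/4.»

WHY.  Road P2's T (`DirichletExhaustionCoer.convC_balaban`, PART 18) is (CONV-C) for the `U = 1` covariance constituent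
`k ↦ C^{(k)}_Λ = C·(pad(CᵀΔ_kC))_Λ⁻¹·Cᵀ` (`DirichletExhaustionCovariancePad.covPad`): `k`-uniform decay AND the one-step rate `θ^k` — a CAUCHY
statement.  PART 2 proves abstractly that the Dirichlet inverses of an `OpFamilyRate` family converge to the Dirichlet inverse of the entrywise
operator limit `opLim` (`dirichletExhaustion_rate`∕`_limit`), but the limit object of T itself was never NAMED.  Once a supplier NAMES the
middle limit `Δ_∞` with the three facts [shape] `OpLimitInput Δ Δ_∞ c₀ δ θ₁ θ` below (entry bound, symmetry, `|Δ_k − Δ_∞| ≤ θ₁θ^k e^{−δ|·|}`) —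
exactly what lineage gan24-p3 (gen 12, `GAN24/EffectiveLaplacianLimit`: `deltaZLim_abs_le`, `deltaZLim_symm`, `deltaZ_sub_deltaZLim_abs_le`)
proves for Bałaban's (1.66) family `(deltaZ L, deltaZLim)` with `(c₀, δ, θ₁, θ) = (c166Z d, kappaZ d, theta166Z d, L⁻²)` — this file gives:
* §2 `opLim (k ↦ pad(CᵀΔ_kC)) = pad(CᵀΔ_∞C)` (`opLim_innerPad_eq`): PART 2's `A_∞` IS the padded sandwich of the named limit, so `pad(CᵀΔ_∞C)`
  inherits (5.6) with the SAME constants (`hyp56Z_innerPadLim`) and its Dirichlet inverse kernels are two-sided inverses BY NAME (§2, B4's Sect. 5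
  Theorem `B4Sect5Exhaustion.tsum_mul_limInv`∕`tsum_limInv_mul`);
* §3 [our object] **`covPadLim C Δ_∞ Free Λ := C·(pad(CᵀΔ_∞C))_Λ⁻¹·Cᵀ`** — the PERFECT covariance of the socket;
* §4 **`covPad_sub_covPadLim_abs_le`**: `|C^{(k)}_Λ − C^{(∞)}_Λ|(b,b′) ≤ limRateConst·θ^k·e^{−(δ⋆∕2)|b−b′|_∞}` on EVERY `Λ ⊆ Ω`, every `k`, with
  `limRateConst = s(c_C,δ⋆)·rateConst(d,N,γ,c′,δ∕2)·s(c_C,δ)·θ₁` (PART 1 `limInv_sub_limInv_rate` at the pair `(A_k, A_∞)`, PART 3 `opClose_sandwich`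
  twice) — NO factor `1∕(1−θ)`: the rate to the NAMED limit has the supplier's constant `θ₁`, not the telescoped tail; `covPadLim_abs_le`
  (decay of `C^{(∞)}_Λ`, constant `s(c_C,δ⋆)·c⋆`); `tendsto_covPad` (`θ < 1`);
* §5 an2's currency: `decays_toMKer_covPadLim`, **`decays_toMKer_covPad_sub_covPadLim`** (`Decays (toMKer C^{(k)}_Λ − toMKer C^{(∞)}_Λ)
  (limRateConst·θ^k) (δ⋆∕(2d))`) = LITERALLY the hypothesis `h` of `Beta.HessKerDressedLimit.limMKerOf_eq_of_decays_rate`∕`tendsto_of_decays_rate`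
  (so an2's constructed limit `limMKerOf (k ↦ toMKer C^{(k)}_Λ)` IS `toMKer C^{(∞)}_Λ` by ONE application of that lemma; not imported here to keep
  road P2's import cone free of the `HessKer*` stack).
Here `s(c,δ) = sandwichConst d N c δ`, `c′ = max{s(c_C,δ)·c₀, 1}`, `δ⋆ = limDeltaStar = deltaStar d N γ c′ (δ∕2)` (PART 10's END constants, unchanged),
`c⋆ = cStar d N γ c′ (δ∕2)`.  PART 24 (`GAN24/DirichletExhaustionPerfectCovariance`) instantiates everything for Bałaban's typed objects
`(elimZ L, deltaZ L, deltaZLim, IsFreeZ L)` on `ℤ^{d+1}` once `GAN24/EffectiveLaplacianLimit` is in the tree.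
HONEST: names a limit object and proves convergence to it with road P2's constants; the S6 dictionary (`covPad` ↔ the wall's `KInvStep`∕an2's
`Gam` block) is NOT asserted; NOT the K-slot, NOT (hS, hSall), NOT (hW, hWall), NOT (CONV-C) as a whole, NEVER «G-an2-4 closed»; NOT D1, NOT
`BetaPertH`, NOT continuum, NOT Clay.

ABSOLUTE RULE (cell, verbatim): «No internally-minted statement may enter as a cited fact. Every hypothesis is either kernel-proved in this package or a
verbatim quotation of a PUBLISHED theorem with page reference. The manuscript(s) under audit are NOT citable for their own disputed steps — they are the
thing under adjudication; programme-internal (2001/route/tribunal) claims are never citable.»  No hypothesis below is a printed statement; [shape]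
`OpLimitInput` is a hypothesis carrier asserted of nothing; every input is a tree theorem used BY NAME; no `def … : Prop` fact is minted.

## What this file proves (0 sorry; imports PARTS 10 and 4 only)
[shape] `OpLimitInput`; `opClose_innerPad_lim`, `tendsto_innerPad`, **`opLim_innerPad_eq`**, `hyp56Z_innerPadLim`, `tsum_innerPadLim_mul_limInv`,
`tsum_limInv_mul_innerPadLim`; [our object] `covPadLim`, `covPadLim_eq_opLim`; constants `limDeltaStar`, `limRateConst`, `limDecayConst` (+ signs);
**`covPad_sub_covPadLim_abs_le`**, `covPadLim_abs_le`, **`tendsto_covPad`**; `decays_toMKer_covPadLim`, **`decays_toMKer_covPad_sub_covPadLim`**.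
NOT summit progress.
-/

namespace Summit.QuantumFields.BalabanUV.Beta.GAN24.DirichletExhaustionLimit

open Finset Real Filter Topology
open Literature.MathematicalPhysics.QuantumFieldTheory.Balaban1983to89
open Literature.MathematicalPhysics.QuantumFieldTheory.Balaban1983to89.Beta
open ExpKernelCalculus (MKer Decays)
open B4Sect5Proof (cStar deltaStar cStar_pos deltaStar_pos)
open B4Sect5Exhaustion (K toMat Hyp56Z limInv limInv_abs_le tsum_mul_limInv tsum_limInv_mul)
open Summit.QuantumFields.BalabanUV.Beta.GAN24.DirichletExhaustion
open Summit.QuantumFields.BalabanUV.Beta.GAN24.DirichletExhaustionFamily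
open Summit.QuantumFields.BalabanUV.Beta.GAN24.DirichletExhaustionSandwich
open Summit.QuantumFields.BalabanUV.Beta.GAN24.DirichletExhaustionCovariance
open Summit.QuantumFields.BalabanUV.Beta.GAN24.DirichletExhaustionCovariancePad
open Summit.QuantumFields.BalabanUV.Beta.GAN24.DirichletExhaustionDecays (toMKer toMKer_sub decays_toMKer_of_bound)

noncomputable section

variable {d N : ℕ}

/-! ## §1 STATEMENT FIRST — the named-limit input, as a shape -/

/-- [shape] **A NAMED LIMIT `Δ_∞` OF THE MIDDLE FAMILY**: `|Δ_∞| ≤ c₀e^{−δ|·|_∞}`, `Δ_∞` symmetric, and `|Δ_k − Δ_∞|(b,b′) ≤ θ₁·θ^k·e^{−δ|b−b′|_∞}`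
on all of `ℤ^d` (`OpClose ℤ^d (Δ k) Δ_∞ (θ₁θ^k) δ`) — the three facts `GAN24/EffectiveLaplacianLimit` proves for `(deltaZ L, deltaZLim)`.
A hypothesis carrier asserted of nothing. -/
structure OpLimitInput (Δ : ℕ → K d N → K d N → ℝ) (Δinf : K d N → K d N → ℝ) (c₀ δ θ₁ θ : ℝ) : Prop where
  bound : ∀ r s : K d N, |Δinf r s| ≤ c₀ * Real.exp (-(δ * dist r.1 s.1))
  symm : ∀ r s : K d N, Δinf r s = Δinf s r
  close : ∀ k, OpClose (Set.univ : Set (Fin d → ℤ)) (Δ k) Δinf (θ₁ * θ ^ k) δ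

/-! ## §2 The padded inner family against its named limit: PART 2's `A_∞` IS `pad(CᵀΔ_∞C)` -/

section Inner

variable {Ω : Set (Fin d → ℤ)} {C : K d N → K d N → ℝ} {Δ : ℕ → K d N → K d N → ℝ} {Δinf : K d N → K d N → ℝ}
  {Free : K d N → Prop} [DecidablePred Free] {cC c₀ δ γ θ₀ θ θ₁ : ℝ}

/-- `|pad(CᵀΔ_kC) − pad(CᵀΔ_∞C)|(b,b′) ≤ s(c_C,δ)·θ₁·θ^k·e^{−(δ∕2)|b−b′|}` on all of `ℤ^d` (PART 3 `opClose_sandwich`, PART 10 `opClose_padOp`). -/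
theorem opClose_innerPad_lim (h : CovInputPad Ω C Δ Free cC c₀ δ γ θ₀ θ) (hinf : OpLimitInput Δ Δinf c₀ δ θ₁ θ) (hδ : 0 < δ)
    (hcC : 0 ≤ cC) (hθ₁ : 0 ≤ θ₁) (hθ : 0 ≤ θ) (k : ℕ) :
    OpClose (Set.univ : Set (Fin d → ℤ)) (padOp Free (sandwich C (Δ k))) (padOp Free (sandwich C Δinf))
      (sandwichConst d N cC δ * (θ₁ * θ ^ k)) (δ / 2) := by
  have hs : 0 ≤ sandwichConst d N cC δ := sandwichConst_nonneg d N cC hδ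
  exact opClose_padOp (by positivity) (opClose_sandwich hδ hcC h.hC (h.hΔ k) hinf.bound (hinf.close k))

/-- Entrywise `pad(CᵀΔ_kC)(b,b′) → pad(CᵀΔ_∞C)(b,b′)` (`0 ≤ θ < 1`). -/
theorem tendsto_innerPad (h : CovInputPad Ω C Δ Free cC c₀ δ γ θ₀ θ) (hinf : OpLimitInput Δ Δinf c₀ δ θ₁ θ) (hδ : 0 < δ)
    (hcC : 0 ≤ cC) (hθ₁ : 0 ≤ θ₁) (hθ : 0 ≤ θ) (hθ1 : θ < 1) (p q : K d N) :
    Tendsto (fun k => padOp Free (sandwich C (Δ k)) p q) atTop (𝓝 (padOp Free (sandwich C Δinf) p q)) := by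
  have hb := tendsto_const_mul_pow (c := sandwichConst d N cC δ) (a := θ₁)
    (e := Real.exp (-(δ / 2 * dist p.1 q.1))) hθ hθ1
  refine tendsto_sub_nhds_zero_iff.1 (squeeze_zero_norm (fun k => ?_) hb)
  rw [Real.norm_eq_abs, abs_sub_comm]
  exact opClose_innerPad_lim h hinf hδ hcC hθ₁ hθ k p q (Set.mem_univ _) (Set.mem_univ _)

/-- **PART 2's entrywise operator limit `opLim (k ↦ pad(CᵀΔ_kC))` IS `pad(CᵀΔ_∞C)`** (uniqueness of limits in `ℝ`, entry by entry, on all of `ℤ^d`). -/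
theorem opLim_innerPad_eq (h : CovInputPad Ω C Δ Free cC c₀ δ γ θ₀ θ) (hinf : OpLimitInput Δ Δinf c₀ δ θ₁ θ) (hδ : 0 < δ)
    (hcC : 0 ≤ cC) (hθ₁ : 0 ≤ θ₁) (hθ : 0 ≤ θ) (hθ1 : θ < 1) :
    opLim (fun k => padOp Free (sandwich C (Δ k))) = padOp Free (sandwich C Δinf) :=
  funext fun p => funext fun q => (tendsto_innerPad h hinf hδ hcC hθ₁ hθ hθ1 p q).limUnder_eq

/-- **`pad(CᵀΔ_∞C)` inherits (5.6) on `Ω` with the SAME constants** `(γ, max{s·c₀,1}, δ∕2)` as every `pad(CᵀΔ_kC)` (PART 2 `hyp56Z_opLim` for the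
padded inner `OpFamilyRate` of PART 10, transported along `opLim_innerPad_eq`). -/
theorem hyp56Z_innerPadLim (h : CovInputPad Ω C Δ Free cC c₀ δ γ θ₀ θ) (hinf : OpLimitInput Δ Δinf c₀ δ θ₁ θ) (hδ : 0 < δ)
    (hcC : 0 ≤ cC) (hθ₀ : 0 ≤ θ₀) (hθ₁ : 0 ≤ θ₁) (hθ : 0 ≤ θ) (hθ1 : θ < 1) :
    Hyp56Z Ω (padOp Free (sandwich C Δinf)) γ (max (sandwichConst d N cC δ * c₀) 1) (δ / 2) := by
  rw [← opLim_innerPad_eq h hinf hδ hcC hθ₁ hθ hθ1]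
  exact hyp56Z_opLim (opFamilyRate_innerPad h hδ hcC hθ₀ hθ) hθ1

/-- The Dirichlet inverse kernel of the named inner limit IS a right inverse of `(pad(CᵀΔ_∞C))_Λ = Λ·pad(CᵀΔ_∞C)·Λ` on `Λ ⊆ Ω` (`γ > 0`):
`Σ_q pad(CᵀΔ_∞C)(p,q)·C_Λ[pad(CᵀΔ_∞C)](q,r) = δ_{pr}` for `p, r ∈ Λ`, absolutely convergent — B4's Sect. 5 Theorem BY NAME. -/
theorem tsum_innerPadLim_mul_limInv (h : CovInputPad Ω C Δ Free cC c₀ δ γ θ₀ θ) (hinf : OpLimitInput Δ Δinf c₀ δ θ₁ θ) (hδ : 0 < δ)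
    (hcC : 0 ≤ cC) (hγ : 0 < γ) (hθ₀ : 0 ≤ θ₀) (hθ₁ : 0 ≤ θ₁) (hθ : 0 ≤ θ) (hθ1 : θ < 1) {Λ : Set (Fin d → ℤ)} (hΛ : Λ ⊆ Ω)
    {p r : K d N} (hp : p.1 ∈ Λ) (hr : r.1 ∈ Λ) :
    ∑' q, padOp Free (sandwich C Δinf) p q * limInv Λ (padOp Free (sandwich C Δinf)) q r = if p = r then 1 else 0 :=
  tsum_mul_limInv hγ (lt_max_of_lt_right one_pos) (half_pos hδ) ((hyp56Z_innerPadLim h hinf hδ hcC hθ₀ hθ₁ hθ hθ1).mono hΛ) hp hr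

/-- … and a left inverse: `Σ_q C_Λ[pad(CᵀΔ_∞C)](p,q)·pad(CᵀΔ_∞C)(q,r) = δ_{pr}` for `p, r ∈ Λ`. -/
theorem tsum_limInv_mul_innerPadLim (h : CovInputPad Ω C Δ Free cC c₀ δ γ θ₀ θ) (hinf : OpLimitInput Δ Δinf c₀ δ θ₁ θ) (hδ : 0 < δ)
    (hcC : 0 ≤ cC) (hγ : 0 < γ) (hθ₀ : 0 ≤ θ₀) (hθ₁ : 0 ≤ θ₁) (hθ : 0 ≤ θ) (hθ1 : θ < 1) {Λ : Set (Fin d → ℤ)} (hΛ : Λ ⊆ Ω)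
    {p r : K d N} (hp : p.1 ∈ Λ) (hr : r.1 ∈ Λ) :
    ∑' q, limInv Λ (padOp Free (sandwich C Δinf)) p q * padOp Free (sandwich C Δinf) q r = if p = r then 1 else 0 :=
  tsum_limInv_mul hγ (lt_max_of_lt_right one_pos) (half_pos hδ) ((hyp56Z_innerPadLim h hinf hδ hcC hθ₀ hθ₁ hθ hθ1).mono hΛ) hp hr

end Inner

/-! ## §3 The perfect covariance of the socket -/

/-- [our object] **THE PERFECT (`k = ∞`) COVARIANCE OF THE PADDED SOCKET**: `covPadLim C Δ_∞ Free Λ = C·(pad(CᵀΔ_∞C))_Λ⁻¹·Cᵀ` — the formula of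
`DirichletExhaustionCovariancePad.covPad` with the NAMED middle limit `Δ_∞` in place of `Δ_k`. -/
def covPadLim (C : K d N → K d N → ℝ) (Δinf : K d N → K d N → ℝ) (Free : K d N → Prop) [DecidablePred Free]
    (Λ : Set (Fin d → ℤ)) : K d N → K d N → ℝ :=
  sandwich (trK C) (limInv Λ (padOp Free (sandwich C Δinf)))

/-- The END constant `δ⋆` of PART 10 (`convC_covPad`), displayed: `limDeltaStar = deltaStar d N γ (max{s(c_C,δ)·c₀, 1}) (δ∕2)`. -/
def limDeltaStar (d N : ℕ) (cC c₀ δ γ : ℝ) : ℝ :=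
  deltaStar d N γ (max (sandwichConst d N cC δ * c₀) 1) (δ / 2)

/-- THE RATE CONSTANT TO THE NAMED LIMIT: `limRateConst = s(c_C,δ⋆)·(rateConst d N γ c′ (δ∕2)·(s(c_C,δ)·θ₁))`, `c′ = max{s(c_C,δ)·c₀, 1}`. -/
def limRateConst (d N : ℕ) (cC c₀ δ γ θ₁ : ℝ) : ℝ :=
  sandwichConst d N cC (limDeltaStar d N cC c₀ δ γ) *
    (rateConst d N γ (max (sandwichConst d N cC δ * c₀) 1) (δ / 2) * (sandwichConst d N cC δ * θ₁))

/-- THE DECAY CONSTANT OF THE PERFECT COVARIANCE: `limDecayConst = s(c_C,δ⋆)·c⋆`, `c⋆ = cStar d N γ c′ (δ∕2)`. -/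
def limDecayConst (d N : ℕ) (cC c₀ δ γ : ℝ) : ℝ :=
  sandwichConst d N cC (limDeltaStar d N cC c₀ δ γ) * cStar d N γ (max (sandwichConst d N cC δ * c₀) 1) (δ / 2)

/-- `limDeltaStar > 0` (`δ, γ > 0`). -/
theorem limDeltaStar_pos (d N : ℕ) (cC c₀ : ℝ) {δ γ : ℝ} (hδ : 0 < δ) (hγ : 0 < γ) : 0 < limDeltaStar d N cC c₀ δ γ :=
  deltaStar_pos d N hγ (lt_max_of_lt_right one_pos).le (half_pos hδ)

/-- `limDeltaStar ≤ δ`. -/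
theorem limDeltaStar_le (d N : ℕ) (cC c₀ : ℝ) {δ : ℝ} (γ : ℝ) (hδ : 0 < δ) : limDeltaStar d N cC c₀ δ γ ≤ δ :=
  (deltaStar_le d N γ _ (half_pos hδ)).trans (by linarith)

/-- `limRateConst ≥ 0` (`δ, γ > 0`, `θ₁ ≥ 0`). -/
theorem limRateConst_nonneg (d N : ℕ) (cC c₀ : ℝ) {δ γ θ₁ : ℝ} (hδ : 0 < δ) (hγ : 0 < γ) (hθ₁ : 0 ≤ θ₁) :
    0 ≤ limRateConst d N cC c₀ δ γ θ₁ := by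
  have h1 := sandwichConst_nonneg d N cC (limDeltaStar_pos d N cC c₀ hδ hγ)
  have h2 := sandwichConst_nonneg d N cC hδ
  have h3 := rateConst_nonneg d N hγ (lt_max_of_lt_right one_pos : (0 : ℝ) < max (sandwichConst d N cC δ * c₀) 1).le (half_pos hδ)
  unfold limRateConst; positivity

/-- `limDecayConst ≥ 0` (`δ, γ > 0`). -/
theorem limDecayConst_nonneg (d N : ℕ) (cC c₀ : ℝ) {δ γ : ℝ} (hδ : 0 < δ) (hγ : 0 < γ) : 0 ≤ limDecayConst d N cC c₀ δ γ := by
  have h1 := sandwichConst_nonneg d N cC (limDeltaStar_pos d N cC c₀ hδ hγ)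
  have h2 := (cStar_pos d N (max (sandwichConst d N cC δ * c₀) 1) (δ / 2) hγ).le
  unfold limDecayConst; positivity

section Limit

variable {Ω : Set (Fin d → ℤ)} {C : K d N → K d N → ℝ} {Δ : ℕ → K d N → K d N → ℝ} {Δinf : K d N → K d N → ℝ}
  {Free : K d N → Prop} [DecidablePred Free] {cC c₀ δ γ θ₀ θ θ₁ : ℝ}

/-- `covPadLim` IS PART 2's limit object read through the outer sandwich: `C·(limInv Λ (opLim (k ↦ pad(CᵀΔ_kC))))·Cᵀ`. -/
theorem covPadLim_eq_opLim (h : CovInputPad Ω C Δ Free cC c₀ δ γ θ₀ θ) (hinf : OpLimitInput Δ Δinf c₀ δ θ₁ θ) (hδ : 0 < δ)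
    (hcC : 0 ≤ cC) (hθ₁ : 0 ≤ θ₁) (hθ : 0 ≤ θ) (hθ1 : θ < 1) (Λ : Set (Fin d → ℤ)) :
    covPadLim C Δinf Free Λ = sandwich (trK C) (limInv Λ (opLim (fun k => padOp Free (sandwich C (Δ k))))) := by
  rw [covPadLim, opLim_innerPad_eq h hinf hδ hcC hθ₁ hθ hθ1]

/-! ## §4 The explicit rate to the named limit, its decay, and the entrywise limit -/

/-- **`covPad_sub_covPadLim_abs_le` — THE RATE TO THE NAMED LIMIT.**  Under `CovInputPad Ω C Δ Free c_C c₀ δ γ θ₀ θ` and `OpLimitInput Δ Δ_∞ c₀ δ θ₁ θ`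
(`c_C ≥ 0`, `δ, γ > 0`, `θ₀, θ₁ ≥ 0`, `0 ≤ θ < 1`), for EVERY `Λ ⊆ Ω`, every `k` and all bonds `b, b′`:
`|C^{(k)}_Λ(b,b′) − C^{(∞)}_Λ(b,b′)| ≤ limRateConst·θ^k·e^{−(δ⋆∕2)|b−b′|_∞}`, `δ⋆ = limDeltaStar`.  Route: PART 1 `limInv_sub_limInv_rate` for the pair
`(pad(CᵀΔ_kC), pad(CᵀΔ_∞C))` (both (5.6) with `(γ, c′, δ∕2)`; `OpClose` with `s·θ₁θ^k`), then PART 3 `opClose_sandwich` for the outer `C·(·)·Cᵀ`. -/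
theorem covPad_sub_covPadLim_abs_le (h : CovInputPad Ω C Δ Free cC c₀ δ γ θ₀ θ) (hinf : OpLimitInput Δ Δinf c₀ δ θ₁ θ) (hδ : 0 < δ)
    (hcC : 0 ≤ cC) (hγ : 0 < γ) (hθ₀ : 0 ≤ θ₀) (hθ₁ : 0 ≤ θ₁) (hθ : 0 ≤ θ) (hθ1 : θ < 1) {Λ : Set (Fin d → ℤ)} (hΛ : Λ ⊆ Ω)
    (k : ℕ) (p q : K d N) :
    |covPad C Δ Free Λ k p q - covPadLim C Δinf Free Λ p q| ≤
      limRateConst d N cC c₀ δ γ θ₁ * θ ^ k * Real.exp (-(limDeltaStar d N cC c₀ δ γ / 2 * dist p.1 q.1)) := by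
  have hF := opFamilyRate_innerPad h hδ hcC hθ₀ hθ
  have hc' : (0 : ℝ) < max (sandwichConst d N cC δ * c₀) 1 := lt_max_of_lt_right one_pos
  have hδs : 0 < limDeltaStar d N cC c₀ δ γ := limDeltaStar_pos d N cC c₀ hδ hγ
  have hs : 0 ≤ sandwichConst d N cC δ := sandwichConst_nonneg d N cC hδ
  have hε : 0 ≤ sandwichConst d N cC δ * (θ₁ * θ ^ k) := by positivity
  have hAinf := hyp56Z_innerPadLim h hinf hδ hcC hθ₀ hθ₁ hθ hθ1
  -- the inner Dirichlet inverse kernels, at the pair `(A_k, A_∞)`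
  have hcloseInv : OpClose (Set.univ : Set (Fin d → ℤ)) (limInv Λ (padOp Free (sandwich C (Δ k))))
      (limInv Λ (padOp Free (sandwich C Δinf)))
      (rateConst d N γ (max (sandwichConst d N cC δ * c₀) 1) (δ / 2) * (sandwichConst d N cC δ * (θ₁ * θ ^ k)))
      (limDeltaStar d N cC c₀ δ γ) := by
    intro r s _ _
    rw [abs_sub_comm]
    exact limInv_sub_limInv_rate hγ hc' (half_pos hδ) hε (hF.hyp56 k) hAinf
      (opClose_mono (opClose_innerPad_lim h hinf hδ hcC hθ₁ hθ k) (Set.subset_univ Ω)) hΛ r s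
  have hInvk : ∀ r s : K d N, |limInv Λ (padOp Free (sandwich C (Δ k))) r s| ≤
      cStar d N γ (max (sandwichConst d N cC δ * c₀) 1) (δ / 2) * Real.exp (-(limDeltaStar d N cC c₀ δ γ * dist r.1 s.1)) :=
    fun r s => limInv_uniform hγ hc' (half_pos hδ) hF hΛ k r s
  have hInvInf : ∀ r s : K d N, |limInv Λ (padOp Free (sandwich C Δinf)) r s| ≤
      cStar d N γ (max (sandwichConst d N cC δ * c₀) 1) (δ / 2) * Real.exp (-(limDeltaStar d N cC c₀ δ γ * dist r.1 s.1)) :=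
    fun r s => limInv_abs_le hγ hc' (half_pos hδ) (hAinf.mono hΛ) r s
  have hD : ∀ r p : K d N, |trK C r p| ≤ cC * Real.exp (-(limDeltaStar d N cC c₀ δ γ * dist r.1 p.1)) :=
    bound_weaken hcC (limDeltaStar_le d N cC c₀ γ hδ) (trK_bound h.hC)
  have hout := opClose_sandwich hδs hcC hD hInvk hInvInf hcloseInv p q (Set.mem_univ _) (Set.mem_univ _)
  unfold covPad covPadLim
  rw [abs_sub_comm]
  refine hout.trans (le_of_eq ?_)
  unfold limRateConst
  ring

/-- **DECAY OF THE PERFECT COVARIANCE**: `|C^{(∞)}_Λ(b,b′)| ≤ limDecayConst·e^{−(δ⋆∕2)|b−b′|_∞}` on every `Λ ⊆ Ω` (PART 3 `sandwich_decay` with the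
middle kernel `C_Λ[pad(CᵀΔ_∞C)]` bounded by B4's (5.7), `B4Sect5Exhaustion.limInv_abs_le`). -/
theorem covPadLim_abs_le (h : CovInputPad Ω C Δ Free cC c₀ δ γ θ₀ θ) (hinf : OpLimitInput Δ Δinf c₀ δ θ₁ θ) (hδ : 0 < δ)
    (hcC : 0 ≤ cC) (hγ : 0 < γ) (hθ₀ : 0 ≤ θ₀) (hθ₁ : 0 ≤ θ₁) (hθ : 0 ≤ θ) (hθ1 : θ < 1) {Λ : Set (Fin d → ℤ)} (hΛ : Λ ⊆ Ω)
    (p q : K d N) :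
    |covPadLim C Δinf Free Λ p q| ≤ limDecayConst d N cC c₀ δ γ * Real.exp (-(limDeltaStar d N cC c₀ δ γ / 2 * dist p.1 q.1)) := by
  have hc' : (0 : ℝ) < max (sandwichConst d N cC δ * c₀) 1 := lt_max_of_lt_right one_pos
  have hδs : 0 < limDeltaStar d N cC c₀ δ γ := limDeltaStar_pos d N cC c₀ hδ hγ
  have hAinf := hyp56Z_innerPadLim h hinf hδ hcC hθ₀ hθ₁ hθ hθ1
  have hInvInf : ∀ r s : K d N, |limInv Λ (padOp Free (sandwich C Δinf)) r s| ≤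
      cStar d N γ (max (sandwichConst d N cC δ * c₀) 1) (δ / 2) * Real.exp (-(limDeltaStar d N cC c₀ δ γ * dist r.1 s.1)) :=
    fun r s => limInv_abs_le hγ hc' (half_pos hδ) (hAinf.mono hΛ) r s
  have hD : ∀ r p : K d N, |trK C r p| ≤ cC * Real.exp (-(limDeltaStar d N cC c₀ δ γ * dist r.1 p.1)) :=
    bound_weaken hcC (limDeltaStar_le d N cC c₀ γ hδ) (trK_bound h.hC)
  unfold covPadLim limDecayConst
  exact sandwich_decay hδs hcC hD hInvInf p q

/-- **`tendsto_covPad` — THE PERFECT COVARIANCE IS THE LIMIT**: `C^{(k)}_Λ(b,b′) → C^{(∞)}_Λ(b,b′)` entrywise on every `Λ ⊆ Ω` (`0 ≤ θ < 1`) — «the limit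
of the covariances is the covariance of the limit Laplacian», both Dirichlet inverses built by B4's exhaustion. -/
theorem tendsto_covPad (h : CovInputPad Ω C Δ Free cC c₀ δ γ θ₀ θ) (hinf : OpLimitInput Δ Δinf c₀ δ θ₁ θ) (hδ : 0 < δ)
    (hcC : 0 ≤ cC) (hγ : 0 < γ) (hθ₀ : 0 ≤ θ₀) (hθ₁ : 0 ≤ θ₁) (hθ : 0 ≤ θ) (hθ1 : θ < 1) {Λ : Set (Fin d → ℤ)} (hΛ : Λ ⊆ Ω)
    (p q : K d N) : Tendsto (fun k => covPad C Δ Free Λ k p q) atTop (𝓝 (covPadLim C Δinf Free Λ p q)) := by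
  have hb := tendsto_const_mul_pow (c := limRateConst d N cC c₀ δ γ θ₁) (a := 1)
    (e := Real.exp (-(limDeltaStar d N cC c₀ δ γ / 2 * dist p.1 q.1))) hθ hθ1
  refine tendsto_sub_nhds_zero_iff.1 (squeeze_zero_norm (fun k => ?_) hb)
  rw [Real.norm_eq_abs, one_mul]
  exact covPad_sub_covPadLim_abs_le h hinf hδ hcC hγ hθ₀ hθ₁ hθ hθ1 hΛ k p q

/-! ## §5 The same in an2's `Decays` currency (ℓ¹ distance, rate `δ⋆∕(2d)`) -/

/-- `Decays (toMKer C^{(∞)}_Λ) limDecayConst (δ⋆∕(2d))`. -/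
theorem decays_toMKer_covPadLim (h : CovInputPad Ω C Δ Free cC c₀ δ γ θ₀ θ) (hinf : OpLimitInput Δ Δinf c₀ δ θ₁ θ) (hδ : 0 < δ)
    (hcC : 0 ≤ cC) (hγ : 0 < γ) (hθ₀ : 0 ≤ θ₀) (hθ₁ : 0 ≤ θ₁) (hθ : 0 ≤ θ) (hθ1 : θ < 1) {Λ : Set (Fin d → ℤ)} (hΛ : Λ ⊆ Ω) :
    Decays (toMKer (covPadLim C Δinf Free Λ)) (limDecayConst d N cC c₀ δ γ) (limDeltaStar d N cC c₀ δ γ / 2 / d) :=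
  decays_toMKer_of_bound (limDecayConst_nonneg d N cC c₀ hδ hγ) (half_pos (limDeltaStar_pos d N cC c₀ hδ hγ)).le
    fun p q => covPadLim_abs_le h hinf hδ hcC hγ hθ₀ hθ₁ hθ hθ1 hΛ p q

/-- **THE RATE TO THE NAMED LIMIT IN `Decays` CURRENCY**: `Decays (toMKer C^{(k)}_Λ − toMKer C^{(∞)}_Λ) (limRateConst·θ^k) (δ⋆∕(2d))` for every `k` — LITERALLY
the hypothesis `h : ∀ k, Decays (K k − Kinf) (c * θ ^ k) δ` of `Beta.HessKerDressedLimit.limMKerOf_eq_of_decays_rate` ∕ `tendsto_of_decays_rate` at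
`K := fun k => toMKer (covPad C Δ Free Λ k)`, `Kinf := toMKer (covPadLim C Δ_∞ Free Λ)`. -/
theorem decays_toMKer_covPad_sub_covPadLim (h : CovInputPad Ω C Δ Free cC c₀ δ γ θ₀ θ) (hinf : OpLimitInput Δ Δinf c₀ δ θ₁ θ)
    (hδ : 0 < δ) (hcC : 0 ≤ cC) (hγ : 0 < γ) (hθ₀ : 0 ≤ θ₀) (hθ₁ : 0 ≤ θ₁) (hθ : 0 ≤ θ) (hθ1 : θ < 1) {Λ : Set (Fin d → ℤ)}
    (hΛ : Λ ⊆ Ω) (k : ℕ) :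
    Decays (toMKer (covPad C Δ Free Λ k) - toMKer (covPadLim C Δinf Free Λ)) (limRateConst d N cC c₀ δ γ θ₁ * θ ^ k)
      (limDeltaStar d N cC c₀ δ γ / 2 / d) := by
  rw [toMKer_sub]
  have hR := limRateConst_nonneg d N cC c₀ hδ hγ hθ₁
  refine decays_toMKer_of_bound (by positivity) (half_pos (limDeltaStar_pos d N cC c₀ hδ hγ)).le fun p q => ?_
  rw [Pi.sub_apply, Pi.sub_apply]
  exact covPad_sub_covPadLim_abs_le h hinf hδ hcC hγ hθ₀ hθ₁ hθ hθ1 hΛ k p q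

/-! ## §6 (v1.1) Uniqueness of the perfect inner inverse -/

/-- **UNIQUENESS (v1.1)**: any entrywise-bounded LEFT-inverse kernel of `(pad(CᵀΔ_∞C))_Λ` vanishing off `Λ` in its second index IS `C_Λ[pad(CᵀΔ_∞C)]` on `Λ × Λ`
(B4's Sect. 5 uniqueness `B4Sect5Exhaustion.eq_limInv_of_left_inverse` BY NAME, for the named limit operator via `hyp56Z_innerPadLim`) — so the inner kernel of the
perfect covariance `covPadLim` is forced by `Δ_∞`, not a choice of exhaustion or of the approximating family. -/
theorem eq_limInv_innerPadLim_of_left_inverse (h : CovInputPad Ω C Δ Free cC c₀ δ γ θ₀ θ) (hinf : OpLimitInput Δ Δinf c₀ δ θ₁ θ)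
    (hδ : 0 < δ) (hcC : 0 ≤ cC) (hγ : 0 < γ) (hθ₀ : 0 ≤ θ₀) (hθ₁ : 0 ≤ θ₁) (hθ : 0 ≤ θ) (hθ1 : θ < 1) {Λ : Set (Fin d → ℤ)}
    (hΛ : Λ ⊆ Ω) {D : K d N → K d N → ℝ} {M : ℝ} (hDM : ∀ p q, |D p q| ≤ M) (hD0 : ∀ p q : K d N, q.1 ∉ Λ → D p q = 0)
    (hDA : ∀ p r : K d N, p.1 ∈ Λ → r.1 ∈ Λ →
      ∑' q, D p q * padOp Free (sandwich C Δinf) q r = if p = r then 1 else 0)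
    {p s : K d N} (hp : p.1 ∈ Λ) (hs : s.1 ∈ Λ) : D p s = limInv Λ (padOp Free (sandwich C Δinf)) p s :=
  B4Sect5Exhaustion.eq_limInv_of_left_inverse hγ (lt_max_of_lt_right one_pos) (half_pos hδ)
    ((hyp56Z_innerPadLim h hinf hδ hcC hθ₀ hθ₁ hθ hθ1).mono hΛ) hDM hD0 hDA hp hs

end Limit

end

end Summit.QuantumFields.BalabanUV.Beta.GAN24.DirichletExhaustionLimit
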